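import Summits.MatrixMultiplication.MatrixMultiplication.Theorems.SoloInformedTransfer

/-!
# Restricted laziness bounds and the constant-class theorem (every chart)

This work, §8.8 (T2′), (T7) (gen 107). Setting of `SoloInformedTransfer`: twisted data `a b c` over the odd part
`G = S¹` with (E), a chart `Φ = (f, g, l)` into `G₀ = S⁰`, full separation `Data.SepAll`, a class map
`κ : G → R` (`κ x = κ y → SignEq x y`), rank `= |S⁰| · r`.

* `card_mul_card_le_of_sub_mem_sub_on` — the translate-averaging lemma for a finset `X₀` of cells.
* RESTRICTED LAZINESS BOUNDS: `Data.card_mul_le_of_b_rowsOn₂` — rows `j ∈ J₀` of `b` agreeing in class on the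
  columns `k ∈ K₁` give `n · |K₁| · |J₀| ≤ r · |S⁰|`; `Data.card_mul_le_of_c_rowsOn₂` — rows `k ∈ K₁` of `c`
  class-constant on `I₀` give `n · |K₁| · |I₀| ≤ r · |S⁰|`; `Data.card_mul_le_of_c_colsOn₂` — rows `k ∈ K₀` of `c`
  agreeing in class on the columns `i ∈ I₁` give `n · |I₁| · |K₀| ≤ r · |S⁰|`.
* `Data.cube_le_two_mul_of_cover` — if every `k` has column `k` of `b` class-constant OR row `k` of `c`
  class-constant, then `n³ ≤ 2 · r · |S⁰|`.
* THE PER-`k` DICHOTOMY `Data.b_col_or_c_row_of_a_const` (no 2-torsion in `S¹`): if `a` has constant sign class,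
  then for every `k` column `k` of `b` or row `k` of `c` is class-constant (two distinct classes `w₁, w₂` admissible
  against `(α, v)` and against `(α, v')` force `v ~ v'`: `signEq_of_adm_adm`).
* `Data.cube_le_two_mul_of_a_const` — THEOREM 8.14: a realization whose `a` has constant sign class has
  `n³ ≤ 2 · r · |S⁰|`, i.e. rank ≥ n³/2, for EVERY chart (the tight family of §8.7 (o5) has rank `2n³`).
References: this work §8.8; CohnUmans2013 (arXiv:1207.6528) Def. 12.
-/

open Pointwise

namespace Summit.MatrixMultiplication.MatrixMultiplication.Theorems.TwistedTPP

namespace FibreLines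

/-- Translate-averaging on a finset of cells: if cells of `X₀` whose chart values differ by an element of `T - T`
carry distinct classes, then `|X₀| · |T| ≤ |R| · |S|` for every finset `S ∋ φ x - t`. [this work, §8.8] -/
theorem card_mul_card_le_of_sub_mem_sub_on {X G₀ R : Type*} [DecidableEq X] [DecidableEq G₀]
    [DecidableEq R] [Fintype R] [AddCommGroup G₀] (φ : X → G₀) (κ : X → R) (X₀ : Finset X) (T S : Finset G₀)
    (hS : ∀ x ∈ X₀, ∀ t ∈ T, φ x - t ∈ S)
    (h : ∀ x ∈ X₀, ∀ x' ∈ X₀, x ≠ x' → φ x - φ x' ∈ T - T → κ x ≠ κ x') :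
    X₀.card * T.card ≤ Fintype.card R * S.card := by
  classical
  let Φ : X × G₀ → R × G₀ := fun p => (κ p.1, φ p.1 - p.2)
  have hmaps : ∀ p ∈ X₀ ×ˢ T, Φ p ∈ (Finset.univ : Finset R) ×ˢ S := by
    rintro ⟨x, t⟩ hp
    simp only [Finset.mem_product] at hp
    simp only [Φ, Finset.mem_product, Finset.mem_univ, true_and]
    exact hS x hp.1 t hp.2
  have hinj : Set.InjOn Φ ↑(X₀ ×ˢ T) := by
    rintro ⟨x, t⟩ hp ⟨x', t'⟩ hp' hΦ
    simp only [Finset.coe_product, Set.mem_prod, Finset.mem_coe] at hp hp'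
    simp only [Φ, Prod.mk.injEq] at hΦ
    obtain ⟨hκ, hφ⟩ := hΦ
    have hdiff : φ x - φ x' = t - t' := sub_eq_sub_iff_sub_eq_sub.mp hφ
    by_cases hxx : x = x'
    · subst hxx
      have ht : t = t' := by
        have h0 : t - t' = 0 := by rw [← hdiff, sub_self]
        exact sub_eq_zero.mp h0
      rw [ht]
    · exact absurd hκ (h x hp.1 x' hp'.1 hxx (hdiff ▸ Finset.sub_mem_sub hp.2 hp'.2))
  have hle := Finset.card_le_card_of_injOn Φ hmaps hinj
  simpa [Finset.card_product, Finset.card_univ] using hle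

variable {ι G : Type*} [AddCommGroup G]

/-- `~` is transitive. -/
theorem SignEq.trans {x y z : G} (h₁ : SignEq x y) (h₂ : SignEq y z) : SignEq x z := by
  rcases h₁ with rfl | rfl
  · exact h₂
  · rcases h₂ with rfl | rfl
    · exact Or.inr rfl
    · exact Or.inl (neg_neg _)

/-- An admissible triple `(x, v, w)` has `w ~ x + v` or `w ~ x - v`. [this work, §8.8] -/
theorem Adm.signEq_add_or_sub {x v w : G} (h : Adm x v w) : SignEq w (x + v) ∨ SignEq w (x - v) := by
  rcases h with h | h | h | h
  · left; right
    have e : w = -(x + v) + (x + v + w) := by abel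
    rw [e, h, add_zero]
  · left; left
    have e : w = (x + v) - (x + v - w) := by abel
    rw [e, h, sub_zero]
  · right; right
    have e : w = -(x - v) + (x - v + w) := by abel
    rw [e, h, add_zero]
  · right; left
    have e : w = (x - v) - (x - v - w) := by abel
    rw [e, h, sub_zero]

/-- In a group without 2-torsion, `y + y = -(y + y)` forces `y = 0`. -/
theorem eq_zero_of_two_two {y : G} (hG : ∀ x : G, x = -x → x = 0) (h : y + y = -(y + y)) : y = 0 := by
  have h2 : y + y = 0 := hG _ h
  have h3 : y = -y := eq_neg_of_add_eq_zero_left h2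
  exact hG _ h3

/-- `α + v ~ α + v'` and `α - v ~ α - v'` force `v ~ v'` (no 2-torsion). [this work, §8.8 (T7)] -/
theorem signEq_of_signEq_add_sub (hG : ∀ x : G, x = -x → x = 0) {α v v' : G}
    (h₁ : SignEq (α + v) (α + v')) (h₂ : SignEq (α - v) (α - v')) : SignEq v v' := by
  rcases h₁ with h₁ | h₁
  · exact Or.inl (add_left_cancel h₁)
  · rcases h₂ with h₂ | h₂
    · exact Or.inl (sub_right_injective h₂)
    · -- α + v = -(α + v') and α - v = -(α - v')  ⟹  4α = 0  ⟹  α = 0  ⟹  v = -v'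
      have hsum : (α + v) + (α - v) = -(α + v') + -(α - v') := by rw [h₁, h₂]
      have e1 : (α + v) + (α - v) = α + α := by abel
      have e2 : -(α + v') + -(α - v') = -(α + α) := by abel
      rw [e1, e2] at hsum
      have hα2 : α + α = 0 := hG _ hsum
      have hα : α = 0 := hG _ (eq_neg_of_add_eq_zero_left hα2)
      right
      have := h₁
      rw [hα, zero_add, zero_add] at this
      exact this

/-- `α + v ~ α - v'` and `α - v ~ α + v'` force `v ~ v'` (no 2-torsion). [this work, §8.8 (T7)] -/
theorem signEq_of_signEq_add_sub' (hG : ∀ x : G, x = -x → x = 0) {α v v' : G}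
    (h₁ : SignEq (α + v) (α - v')) (h₂ : SignEq (α - v) (α + v')) : SignEq v v' := by
  rcases h₁ with h₁ | h₁
  · right
    have := add_left_cancel (h₁.trans (sub_eq_add_neg α v'))
    exact this
  · rcases h₂ with h₂ | h₂
    · right
      have e : v = α - (α - v) := by abel
      rw [e, h₂]
      abel
    · -- α + v = -(α - v') and α - v = -(α + v')  ⟹  4α = 0  ⟹  α = 0  ⟹  v = v'
      have hsum : (α + v) + (α - v) = -(α - v') + -(α + v') := by rw [h₁, h₂]
      have e1 : (α + v) + (α - v) = α + α := by abel
      have e2 : -(α - v') + -(α + v') = -(α + α) := by abel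
      rw [e1, e2] at hsum
      have hα2 : α + α = 0 := hG _ hsum
      have hα : α = 0 := hG _ (eq_neg_of_add_eq_zero_left hα2)
      left
      have := h₁
      rw [hα, zero_add, zero_sub, neg_neg] at this
      exact this

/-- **Two classes pin the middle entry.** If `w₁ ≁ w₂` are both admissible against `(α, v)` and both against
`(α, v')`, then `v ~ v'` (no 2-torsion): `{[α + v], [α - v]} = {[w₁], [w₂]} = {[α + v'], [α - v']}`.
[this work, §8.8 (T7)] -/
theorem signEq_of_adm_adm (hG : ∀ x : G, x = -x → x = 0) {α v v' w₁ w₂ : G}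
    (h₁ : Adm α v w₁) (h₂ : Adm α v w₂) (h₁' : Adm α v' w₁) (h₂' : Adm α v' w₂) (hw : ¬ SignEq w₁ w₂) :
    SignEq v v' := by
  -- sort w₁, w₂ into the two classes of (α, v) and of (α, v')
  rcases h₁.signEq_add_or_sub with a₁ | a₁ <;> rcases h₂.signEq_add_or_sub with a₂ | a₂
  · exact absurd (a₁.trans a₂.symm) hw
  · rcases h₁'.signEq_add_or_sub with b₁ | b₁ <;> rcases h₂'.signEq_add_or_sub with b₂ | b₂
    · exact absurd (b₁.trans b₂.symm) hw
    · exact signEq_of_signEq_add_sub hG (a₁.symm.trans b₁) (a₂.symm.trans b₂)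
    · exact signEq_of_signEq_add_sub' hG (a₁.symm.trans b₁) (a₂.symm.trans b₂)
    · exact absurd (b₁.trans b₂.symm) hw
  · rcases h₁'.signEq_add_or_sub with b₁ | b₁ <;> rcases h₂'.signEq_add_or_sub with b₂ | b₂
    · exact absurd (b₁.trans b₂.symm) hw
    · exact (signEq_of_signEq_add_sub' hG (a₂.symm.trans b₂) (a₁.symm.trans b₁))
    · exact (signEq_of_signEq_add_sub hG (a₂.symm.trans b₂) (a₁.symm.trans b₁))
    · exact absurd (b₁.trans b₂.symm) hw
  · exact absurd (a₁.trans a₂.symm) hw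

/-- **Per-`k` dichotomy for constant-class `a`.** If every cell of `a` lies in the class of `α`, then for every `k`
either column `k` of `b` is class-constant or row `k` of `c` is class-constant. [this work, §8.8 (T7)] -/
theorem Data.b_col_or_c_row_of_a_const (hG : ∀ x : G, x = -x → x = 0) (D : Data ι G) {α : G}
    (ha : ∀ i j, SignEq (D.a i j) α) (k : ι) :
    (∀ j j', SignEq (D.b j' k) (D.b j k)) ∨ (∀ i i'', SignEq (D.c k i) (D.c k i'')) := by
  classical
  by_cases hc : ∀ i i'', SignEq (D.c k i) (D.c k i'')
  · exact Or.inr hc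
  · left
    push Not at hc
    obtain ⟨i₁, i₂, hw⟩ := hc
    intro j j'
    have e := fun i j => (D.adm_eqn i j k).of_signEq_left (ha i j)
    exact signEq_of_adm_adm hG (e i₁ j') (e i₂ j') (e i₁ j) (e i₂ j) hw

variable {G₀ R : Type*} [AddCommGroup G₀]

/-- **Rows `j ∈ J₀` of `b` agreeing in class on the columns `k ∈ K₁` ⟹ `n · |K₁| · |J₀| ≤ r · |S⁰|`**
(averaging over the `c`-cells `(k, i)` with `k ∈ K₁`, chart `f i + l k`, `T = g(J₀)`). [this work, §8.8 (T2′)] -/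
theorem Data.card_mul_le_of_b_rowsOn₂ [Fintype ι] [DecidableEq ι] [Fintype G₀] [DecidableEq G₀]
    [Fintype R] [DecidableEq R] (D : Data ι G) (Φ : Chart ι G₀) (κ : G → R)
    (hκ : ∀ x y, κ x = κ y → SignEq x y) (hsep : D.SepAll Φ) (J₀ K₁ : Finset ι)
    (hb : ∀ j ∈ J₀, ∀ j' ∈ J₀, ∀ k ∈ K₁, SignEq (D.b j' k) (D.b j k)) :
    Fintype.card ι * K₁.card * J₀.card ≤ Fintype.card R * Fintype.card G₀ := by
  classical
  rcases K₁.eq_empty_or_nonempty with hK | ⟨k₀, hk₀⟩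
  · simp [hK]
  rcases isEmpty_or_nonempty ι with hι | ⟨⟨i₀⟩⟩
  · simp
  have hg : Set.InjOn Φ.g ↑J₀ := by
    intro j hj j' hj' hgg
    by_contra hne
    have hF : Φ.F i₀ j k₀ = Φ.F i₀ j' k₀ := by simp [Chart.F, hgg]
    have hs := hsep i₀ j k₀ i₀ j' k₀ hF (by simp [hne])
    exact D.c_not_signEq_of_b_rows (hb j hj j' hj' k₀ hk₀) hs (SignEq.refl _)
  have hT : (J₀.image Φ.g).card = J₀.card := Finset.card_image_of_injOn hg
  have key := card_mul_card_le_of_sub_mem_sub_on (X := ι × ι) (fun z => Φ.f z.2 + Φ.l z.1)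
    (fun z => κ (D.c z.1 z.2)) (K₁ ×ˢ (Finset.univ : Finset ι)) (J₀.image Φ.g) Finset.univ
    (fun _ _ _ _ => Finset.mem_univ _) ?_
  · have hX : (K₁ ×ˢ (Finset.univ : Finset ι)).card = K₁.card * Fintype.card ι := by
      simp [Finset.card_product]
    rw [hX, hT, Finset.card_univ] at key
    calc Fintype.card ι * K₁.card * J₀.card = K₁.card * Fintype.card ι * J₀.card := by ring
      _ ≤ Fintype.card R * Fintype.card G₀ := key
  · rintro ⟨k, i⟩ hx ⟨k', i'⟩ hx' hne hmem hκeq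
    simp only [Finset.mem_product, Finset.mem_univ, and_true] at hx hx'
    rw [Finset.mem_sub] at hmem
    obtain ⟨t, ht, t', ht', htt⟩ := hmem
    rw [Finset.mem_image] at ht ht'
    obtain ⟨j, hj, rfl⟩ := ht
    obtain ⟨j', hj', rfl⟩ := ht'
    have hF : Φ.F i j' k = Φ.F i' j k' := by
      simp only [Chart.F]
      have e : Φ.f i + Φ.l k - (Φ.f i' + Φ.l k') = Φ.g j - Φ.g j' := by simpa using htt.symm
      have e2 : Φ.f i + Φ.g j' + Φ.l k - (Φ.f i' + Φ.g j + Φ.l k') =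
          (Φ.f i + Φ.l k - (Φ.f i' + Φ.l k')) - (Φ.g j - Φ.g j') := by abel
      rw [← sub_eq_zero, e2, e, sub_self]
    have hneq : (i, j', k) ≠ (i', j, k') := by
      intro heq
      simp only [Prod.mk.injEq] at heq
      exact hne (by rw [heq.1, heq.2.2])
    have hs := hsep i j' k i' j k' hF hneq
    exact D.c_not_signEq_of_b_rows (hb j' hj' j hj k hx) hs (hκ _ _ hκeq)

/-- **Rows `k ∈ K₁` of `c` class-constant on `I₀` ⟹ `n · |K₁| · |I₀| ≤ r · |S⁰|`** (averaging over the `b`-cells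
`(j, k)` with `k ∈ K₁`, chart `l k - g j`, `T = f(I₀)`). [this work, §8.8 (T2′)] -/
theorem Data.card_mul_le_of_c_rowsOn₂ [Fintype ι] [DecidableEq ι] [Fintype G₀] [DecidableEq G₀]
    [Fintype R] [DecidableEq R] (D : Data ι G) (Φ : Chart ι G₀) (κ : G → R)
    (hκ : ∀ x y, κ x = κ y → SignEq x y) (hsep : D.SepAll Φ) (I₀ K₁ : Finset ι)
    (hc : ∀ k ∈ K₁, ∀ i ∈ I₀, ∀ i'' ∈ I₀, SignEq (D.c k i) (D.c k i'')) :
    Fintype.card ι * K₁.card * I₀.card ≤ Fintype.card R * Fintype.card G₀ := by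
  classical
  rcases K₁.eq_empty_or_nonempty with hK | ⟨k₀, hk₀⟩
  · simp [hK]
  have hf : Set.InjOn Φ.f ↑I₀ := by
    intro i hi i'' hi'' hff
    by_contra hne
    have hF : Φ.F i i k₀ = Φ.F i'' i k₀ := by simp [Chart.F, hff]
    have hs := hsep i i k₀ i'' i k₀ hF (by simp [hne])
    exact D.b_not_signEq_of_c_row (hc k₀ hk₀ i hi i'' hi'') hs (SignEq.refl _)
  have hT : (I₀.image Φ.f).card = I₀.card := Finset.card_image_of_injOn hf
  have key := card_mul_card_le_of_sub_mem_sub_on (X := ι × ι) (fun z => Φ.l z.2 - Φ.g z.1)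
    (fun z => κ (D.b z.1 z.2)) ((Finset.univ : Finset ι) ×ˢ K₁) (I₀.image Φ.f) Finset.univ
    (fun _ _ _ _ => Finset.mem_univ _) ?_
  · have hX : ((Finset.univ : Finset ι) ×ˢ K₁).card = Fintype.card ι * K₁.card := by
      simp [Finset.card_product]
    rw [hX, hT, Finset.card_univ] at key
    exact key
  · rintro ⟨j, k⟩ hx ⟨j', k'⟩ hx' hne hmem hκeq
    simp only [Finset.mem_product, Finset.mem_univ, true_and] at hx hx'
    rw [Finset.mem_sub] at hmem
    obtain ⟨t, ht, t', ht', htt⟩ := hmem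
    rw [Finset.mem_image] at ht ht'
    obtain ⟨i'', hi'', rfl⟩ := ht
    obtain ⟨i, hi, rfl⟩ := ht'
    have hF : Φ.F i j' k = Φ.F i'' j k' := by
      simp only [Chart.F]
      have e : Φ.l k - Φ.g j - (Φ.l k' - Φ.g j') = Φ.f i'' - Φ.f i := by simpa using htt.symm
      have e2 : Φ.f i + Φ.g j' + Φ.l k - (Φ.f i'' + Φ.g j + Φ.l k') =
          (Φ.l k - Φ.g j - (Φ.l k' - Φ.g j')) - (Φ.f i'' - Φ.f i) := by abel
      rw [← sub_eq_zero, e2, e, sub_self]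
    have hneq : (i, j', k) ≠ (i'', j, k') := by
      intro heq
      simp only [Prod.mk.injEq] at heq
      exact hne (by rw [heq.2.1, heq.2.2])
    have hs := hsep i j' k i'' j k' hF hneq
    exact D.b_not_signEq_of_c_row (hc k' hx' i hi i'' hi'') hs ((hκ _ _ hκeq).symm)

/-- **Rows `k ∈ K₀` of `c` agreeing in class on the columns `i ∈ I₁` ⟹ `n · |I₁| · |K₀| ≤ r · |S⁰|`**
(averaging over the `a`-cells `(i, j)` with `i ∈ I₁`, chart `f i + g j`, `T = l(K₀)`). [this work, §8.8 (T2′)] -/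
theorem Data.card_mul_le_of_c_colsOn₂ [Fintype ι] [DecidableEq ι] [Fintype G₀] [DecidableEq G₀]
    [Fintype R] [DecidableEq R] (D : Data ι G) (Φ : Chart ι G₀) (κ : G → R)
    (hκ : ∀ x y, κ x = κ y → SignEq x y) (hsep : D.SepAll Φ) (I₁ K₀ : Finset ι)
    (hc : ∀ k ∈ K₀, ∀ k'' ∈ K₀, ∀ i ∈ I₁, SignEq (D.c k'' i) (D.c k i)) :
    Fintype.card ι * I₁.card * K₀.card ≤ Fintype.card R * Fintype.card G₀ := by
  classical
  rcases I₁.eq_empty_or_nonempty with hI | ⟨i₀, hi₀⟩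
  · simp [hI]
  have hl : Set.InjOn Φ.l ↑K₀ := by
    intro k hk k'' hk'' hll
    by_contra hne
    have hF : Φ.F i₀ i₀ k = Φ.F i₀ i₀ k'' := by simp [Chart.F, hll]
    have hs := hsep i₀ i₀ k i₀ i₀ k'' hF (by simp [hne])
    exact D.a_not_signEq_of_c_col (hc k'' hk'' k hk i₀ hi₀) hs (SignEq.refl _)
  have hT : (K₀.image Φ.l).card = K₀.card := Finset.card_image_of_injOn hl
  have key := card_mul_card_le_of_sub_mem_sub_on (X := ι × ι) (fun x => Φ.f x.1 + Φ.g x.2)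
    (fun x => κ (D.a x.1 x.2)) (I₁ ×ˢ (Finset.univ : Finset ι)) (K₀.image Φ.l) Finset.univ
    (fun _ _ _ _ => Finset.mem_univ _) ?_
  · have hX : (I₁ ×ˢ (Finset.univ : Finset ι)).card = I₁.card * Fintype.card ι := by
      simp [Finset.card_product]
    rw [hX, hT, Finset.card_univ] at key
    calc Fintype.card ι * I₁.card * K₀.card = I₁.card * Fintype.card ι * K₀.card := by ring
      _ ≤ Fintype.card R * Fintype.card G₀ := key
  · rintro ⟨i', j'⟩ hx ⟨i, j⟩ hx' hne hmem hκeq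
    simp only [Finset.mem_product, Finset.mem_univ, and_true] at hx hx'
    rw [Finset.mem_sub] at hmem
    obtain ⟨t, ht, t', ht', htt⟩ := hmem
    rw [Finset.mem_image] at ht ht'
    obtain ⟨k'', hk'', rfl⟩ := ht
    obtain ⟨k, hk, rfl⟩ := ht'
    have hF : Φ.F i j k'' = Φ.F i' j' k := by
      simp only [Chart.F]
      have e : Φ.f i' + Φ.g j' - (Φ.f i + Φ.g j) = Φ.l k'' - Φ.l k := by simpa using htt.symm
      have e2 : Φ.f i + Φ.g j + Φ.l k'' - (Φ.f i' + Φ.g j' + Φ.l k) =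
          (Φ.l k'' - Φ.l k) - (Φ.f i' + Φ.g j' - (Φ.f i + Φ.g j)) := by abel
      rw [← sub_eq_zero, e2, e, sub_self]
    have hneq : (i, j, k'') ≠ (i', j', k) := by
      intro heq
      simp only [Prod.mk.injEq] at heq
      exact hne (by rw [heq.1, heq.2.1])
    have hs := hsep i j k'' i' j' k hF hneq
    exact D.a_not_signEq_of_c_col (hc k hk k'' hk'' i' hx) hs (hκ _ _ hκeq)

/-- **Cover theorem.** If every `k` has column `k` of `b` class-constant or row `k` of `c` class-constant, then
`n³ ≤ 2 · (r · |S⁰|)`. [this work, §8.8 (T7)] -/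
theorem Data.cube_le_two_mul_of_cover [Fintype ι] [DecidableEq ι] [Fintype G₀] [DecidableEq G₀]
    [Fintype R] [DecidableEq R] (D : Data ι G) (Φ : Chart ι G₀) (κ : G → R)
    (hκ : ∀ x y, κ x = κ y → SignEq x y) (hsep : D.SepAll Φ)
    (hcover : ∀ k, (∀ j j', SignEq (D.b j' k) (D.b j k)) ∨ (∀ i i'', SignEq (D.c k i) (D.c k i''))) :
    Fintype.card ι ^ 3 ≤ 2 * (Fintype.card R * Fintype.card G₀) := by
  classical
  set Kb : Finset ι := Finset.univ.filter fun k => ∀ j j', SignEq (D.b j' k) (D.b j k) with hKb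
  set Kc : Finset ι := Finset.univ.filter fun k => ∀ i i'', SignEq (D.c k i) (D.c k i'') with hKc
  have h1 := D.card_mul_le_of_b_rowsOn₂ Φ κ hκ hsep Finset.univ Kb
    (fun j _ j' _ k hk => by
      have hk' := (Finset.mem_filter.mp hk).2
      exact hk' j j')
  have h2 := D.card_mul_le_of_c_rowsOn₂ Φ κ hκ hsep Finset.univ Kc
    (fun k hk i _ i'' _ => by
      have hk' := (Finset.mem_filter.mp hk).2
      exact hk' i i'')
  rw [Finset.card_univ] at h1 h2
  have hcov : (Finset.univ : Finset ι) ⊆ Kb ∪ Kc := by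
    intro k _
    rcases hcover k with hk | hk
    · exact Finset.mem_union_left _ (Finset.mem_filter.mpr ⟨Finset.mem_univ _, hk⟩)
    · exact Finset.mem_union_right _ (Finset.mem_filter.mpr ⟨Finset.mem_univ _, hk⟩)
  have hn : Fintype.card ι ≤ Kb.card + Kc.card := by
    calc Fintype.card ι = (Finset.univ : Finset ι).card := Finset.card_univ.symm
      _ ≤ (Kb ∪ Kc).card := Finset.card_le_card hcov
      _ ≤ Kb.card + Kc.card := Finset.card_union_le _ _
  set n := Fintype.card ι
  set M := Fintype.card R * Fintype.card G₀
  calc n ^ 3 = n * n * n := by ring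
    _ ≤ n * n * (Kb.card + Kc.card) := Nat.mul_le_mul_left _ hn
    _ = n * Kb.card * n + n * Kc.card * n := by ring
    _ ≤ M + M := Nat.add_le_add h1 h2
    _ = 2 * M := by ring

/-- **THEOREM 8.14 (constant-class `a`, every chart).** If `S¹` has no 2-torsion and every cell of `a` lies in one
sign class, then `n³ ≤ 2 · (r · |S⁰|)`: rank ≥ n³/2. [this work, §8.8 (T7)] -/
theorem Data.cube_le_two_mul_of_a_const [Fintype ι] [DecidableEq ι] [Fintype G₀] [DecidableEq G₀]
    [Fintype R] [DecidableEq R] (hG : ∀ x : G, x = -x → x = 0) (D : Data ι G) (Φ : Chart ι G₀)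
    (κ : G → R) (hκ : ∀ x y, κ x = κ y → SignEq x y) (hsep : D.SepAll Φ) {α : G}
    (ha : ∀ i j, SignEq (D.a i j) α) :
    Fintype.card ι ^ 3 ≤ 2 * (Fintype.card R * Fintype.card G₀) :=
  D.cube_le_two_mul_of_cover Φ κ hκ hsep (D.b_col_or_c_row_of_a_const hG ha)

end FibreLines

end Summit.MatrixMultiplication.MatrixMultiplication.Theorems.TwistedTPP
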